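import Summits.BirchSwinnertonDyer.BirchSwinnertonDyer.Theorems.CyclotomicUntwistSecondKindDefect
import HarnessLib

/-!
# Route `CyclotomicUntwist`: second-kind series `log_W ∘ g` — `g` is an endomorphism mod `p` (STEP B), and the
# digit step `log_W(g) ≡ a·log_W + log_W(g′)(Xᵖ) (mod ℤ_p⟦X⟧)`

Cell `pub/bsd-wall` (D-0145 line `route-BirchSwinnertonDyer-CyclotomicUntwist`), prover seat `bsd-line-cycu-p3` (gen 8),
memo `KATZ-FROBENIUS-MOD-VARPI-v2` §2 (iii)–(iv), work package W3 toward the registered stub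
`stub_KATZ_rankLeTwo_supersingular` of K1 = stmt-BirchSwinnertonDyer-21580 (binder H3 of cycu-p4's W4 assembly).
THEOREMS ONLY; `--supports` K1. BSD is not proved by this file and no crux is.

## Setting (general odd `p`)

`V/ℤ_p` with elliptic generic fibre `W = V ⊗ ℚ_p` and elliptic special fibre `V ⊗ 𝔽_p`, `F = F_W` (`= F_V`, integral),
`F̄ = F_{V ⊗ 𝔽_p}`, `ℓ = log_W`, `i = formalNeg`. For `g ∈ Xℤ_p⟦X⟧` write `ḡ ∈ X𝔽_p⟦X⟧` for its reduction and call `g` an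
*endomorphism mod `p`* when `ḡ(F̄(X,Y)) = F̄(ḡ(X), ḡ(Y))`.

* (`CyclotomicUntwistSecondKindDefect`) exact identities for the *defect* `γ_g = F(g(F), i(F(g(X), g(Y))))`:
  `ℓ(γ_g) = ∂(ℓ∘g)` and `g(F) = F(γ_g, F(g(X), g(Y)))`, base change.
* §2 **STEP B** `isHom_map_toZMod_of_cob`: if `pᵐ·∂(ℓ∘g) ∈ ℤ_p⟦X,Y⟧` then `g` is an endomorphism mod `p` (LEMMA Λ of
  cycu-p4, `FormalLogDivisibility`: `p ∣ γ_g`; reduce `g(F) = F(γ_g, F(gX, gY))` modulo `p`). Conversely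
  `isPadicInt_cob_of_isHom`: for an endomorphism mod `p`, `∂(ℓ∘g) ∈ ℤ_p⟦X,Y⟧` (`γ̄_g = F̄(T, i(T)) = 0`).
* §3 **DIGIT STEP** `digit_step`: for an endomorphism `g` mod `p` there are a digit `a < p` and an endomorphism `g′`
  mod `p` with `ℓ(g) − a·ℓ − ℓ(g′)(Xᵖ) ∈ ℤ_p⟦X⟧`: `g₁ = F(g, i([a]))` has `ℓ(g₁) = ℓ(g) − aℓ` and `[X¹]ḡ₁ = 0`, so
  `ḡ₁ = ē(Xᵖ)` with `ē` an endomorphism (`FormalEndomorphism.exists_hom_expand_of_coeff_one_eq_zero`, p636477); lift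
  `ē` to `g′`; `g₁ ⊖ g′(Xᵖ) ≡ 0 (mod p)` gives `ℓ(g₁) − ℓ(g′(Xᵖ)) ∈ ℤ_p⟦X⟧` by Λ.

[cite: Katz1981CrystallineDieudonne, §5.1 and Thm 5.3.3] [cite: SilvermanAEC2009, IV.4.3, IV.6.3, IV.7]
-/

set_option autoImplicit false
-- single-conjunct summit: `Summit.BirchSwinnertonDyer.BirchSwinnertonDyer.…` repeats the name by design
set_option linter.dupNamespace false

noncomputable section

open PowerSeries Literature.NumberTheory.EllipticCurves
  Summit.BirchSwinnertonDyer.BirchSwinnertonDyer.Theorems.FormalLogDivisibility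
  Summit.BirchSwinnertonDyer.BirchSwinnertonDyer.Theorems.FormalEndomorphism

namespace Summit.BirchSwinnertonDyer.BirchSwinnertonDyer.Theorems.SecondKindLog

variable {p : ℕ} [hp : Fact p.Prime]

/-! ## §2 STEP B: `pᵐ·∂(ℓ∘g) ∈ ℤ_p⟦X,Y⟧` ⟹ `g` is an endomorphism modulo `p`; and the converse -/

section Reduction

variable (V : WeierstrassCurve ℤ_[p]) [hE : (V.map PadicInt.Coe.ringHom).IsElliptic]
  [hEt : (V.map PadicInt.toZMod).IsElliptic] (G : ℤ_[p]⟦X⟧) (hG0 : constantCoeff G = 0)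

omit hE hEt in
include hG0 in
/-- `G ⊗ ℚ_p` and `G ⊗ 𝔽_p` have no constant term. [folklore] -/
theorem constantCoeff_map_coe_and_toZMod :
    constantCoeff (G.map (PadicInt.Coe.ringHom (p := p))) = 0 ∧ constantCoeff (G.map (PadicInt.toZMod (p := p))) = 0 := by
  rw [← coeff_zero_eq_constantCoeff, coeff_map, coeff_zero_eq_constantCoeff, hG0, map_zero,
    ← coeff_zero_eq_constantCoeff, coeff_map, coeff_zero_eq_constantCoeff, hG0, map_zero]
  exact ⟨rfl, rfl⟩

include hG0 in
/-- **STEP B.** For `G ∈ Xℤ_p⟦X⟧`: if the `F_W`-coboundary of `log_W ∘ G` has `pᵐ`-bounded denominators, then `Ḡ` is an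
endomorphism of `F̄ = F_{V ⊗ 𝔽_p}`: `Ḡ(F̄(X,Y)) = F̄(Ḡ(X), Ḡ(Y))`. Proof: `∂(ℓ∘G) = ℓ(γ_G)` for the integral defect
`γ_G = F(G(F), i(F(GX, GY)))`, so LEMMA Λ gives `p ∣ γ_G`; reduce `G(F) = F(γ_G, F(GX, GY))` modulo `p`.
[cite: Katz1981CrystallineDieudonne, Thm. 5.3.3] [cite: SilvermanAEC2009, IV.6.3, IV.7] -/
theorem isHom_map_toZMod_of_cob (hp2 : p ≠ 2) {m : ℕ}
    (h : IsPadicInt (MvPowerSeries.C ((p : ℚ_[p]) ^ m) *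
      (PowerSeries.subst (V.map PadicInt.Coe.ringHom).formalGroupLaw
          ((V.map PadicInt.Coe.ringHom).formalLog.subst (G.map PadicInt.Coe.ringHom)) -
        PowerSeries.subst (MvPowerSeries.X 0 : MvPowerSeries (Fin 2) ℚ_[p])
          ((V.map PadicInt.Coe.ringHom).formalLog.subst (G.map PadicInt.Coe.ringHom)) -
        PowerSeries.subst (MvPowerSeries.X 1 : MvPowerSeries (Fin 2) ℚ_[p])
          ((V.map PadicInt.Coe.ringHom).formalLog.subst (G.map PadicInt.Coe.ringHom))))) :
    (G.map PadicInt.toZMod).subst (V.map PadicInt.toZMod).formalGroupLaw =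
      MvPowerSeries.subst ![(G.map PadicInt.toZMod).subst (MvPowerSeries.X 0 : MvPowerSeries (Fin 2) (ZMod p)),
        (G.map PadicInt.toZMod).subst (MvPowerSeries.X 1 : MvPowerSeries (Fin 2) (ZMod p))]
        (V.map PadicInt.toZMod).formalGroupLaw := by
  set ιQ := PadicInt.Coe.ringHom (p := p) with hιQ
  set W := V.map ιQ with hWdef
  set g := G.map ιQ with hgdef
  have hg0 : constantCoeff g = 0 := (constantCoeff_map_coe_and_toZMod G hG0).1
  -- the defect over `ℤ_p` and over `ℚ_p`
  set γZ : MvPowerSeries (Fin 2) ℤ_[p] := MvPowerSeries.subst ![G.subst V.formalGroupLaw, V.formalNeg.subst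
    (MvPowerSeries.subst ![G.subst (MvPowerSeries.X 0 : MvPowerSeries (Fin 2) ℤ_[p]),
      G.subst (MvPowerSeries.X 1 : MvPowerSeries (Fin 2) ℤ_[p])] V.formalGroupLaw)] V.formalGroupLaw with hγZ
  have hγmap : γZ.map ιQ = MvPowerSeries.subst ![g.subst W.formalGroupLaw, W.formalNeg.subst
      (MvPowerSeries.subst ![g.subst (MvPowerSeries.X 0 : MvPowerSeries (Fin 2) ℚ_[p]),
        g.subst (MvPowerSeries.X 1 : MvPowerSeries (Fin 2) ℚ_[p])] W.formalGroupLaw)] W.formalGroupLaw :=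
    map_defect V ιQ G hG0
  have hγint : IsPadicInt (γZ.map ιQ) := isPadicInt_map γZ
  have hγ0 : MvPowerSeries.constantCoeff (γZ.map ιQ) = 0 := by rw [hγmap]; exact constantCoeff_defect W g hg0
  -- LEMMA Λ: `p ∣ γ`
  have hℓγ : W.formalLog.subst (γZ.map ιQ) = PowerSeries.subst W.formalGroupLaw (W.formalLog.subst g) -
      PowerSeries.subst (MvPowerSeries.X 0 : MvPowerSeries (Fin 2) ℚ_[p]) (W.formalLog.subst g) -
      PowerSeries.subst (MvPowerSeries.X 1 : MvPowerSeries (Fin 2) ℚ_[p]) (W.formalLog.subst g) := by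
    rw [hγmap]; exact formalLog_subst_defect W g hg0
  have hΛ : IsPadicInt (MvPowerSeries.C (p : ℚ_[p])⁻¹ * γZ.map ιQ) :=
    (isPadicInt_inv_mul_iff_exists_isPadicInt_pow_mul_formalLog_subst V hp2 hγint hγ0).mpr ⟨m, by rwa [hℓγ]⟩
  have hred : γZ.map PadicInt.toZMod = 0 := map_toZMod_eq_zero_of_isPadicInt_inv_mul γZ hΛ
  -- the identity `G(F) = F(γ, F(GX, GY))` over `ℤ_p`
  have hZ : G.subst V.formalGroupLaw = MvPowerSeries.subst ![γZ,
      MvPowerSeries.subst ![G.subst (MvPowerSeries.X 0 : MvPowerSeries (Fin 2) ℤ_[p]),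
        G.subst (MvPowerSeries.X 1 : MvPowerSeries (Fin 2) ℤ_[p])] V.formalGroupLaw] V.formalGroupLaw := by
    apply WeierstrassCurve.mvPowerSeries_map_injective (φ := ιQ) (fun _ _ hab ↦ Subtype.ext hab)
    have hγZ0 : MvPowerSeries.constantCoeff γZ = 0 := constantCoeff_defect V G hG0
    rw [map_subst_formalGroupLaw V ιQ G, V.map_subst_pair_formalGroupLaw ιQ hγZ0 (constantCoeff_pair V G hG0),
      map_pair V ιQ G hG0, hγmap]
    exact subst_formalGroupLaw_eq_defect W g hg0
  -- reduce modulo `p`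
  have hbar := congrArg (MvPowerSeries.map (PadicInt.toZMod (p := p))) hZ
  rw [map_subst_formalGroupLaw V PadicInt.toZMod G,
    V.map_subst_pair_formalGroupLaw PadicInt.toZMod (constantCoeff_defect V G hG0) (constantCoeff_pair V G hG0),
    hred, map_pair V PadicInt.toZMod G hG0, WeierstrassCurve.formalGroupLaw_subst_zero] at hbar
  · exact hbar
  · exact PowerSeries.HasSubst.of_constantCoeff_zero
      (constantCoeff_pair (V.map PadicInt.toZMod) (G.map PadicInt.toZMod) (constantCoeff_map_coe_and_toZMod G hG0).2)

omit hE hEt in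
include hG0 in
/-- **Converse: an endomorphism mod `p` has INTEGRAL coboundary.** If `Ḡ(F̄) = F̄(ḠX, ḠY)` then `γ̄_G = F̄(T, i(T)) = 0`,
so `p ∣ γ_G` and `∂(ℓ∘G) = ℓ(γ_G) = ℓ(p·γ′) ∈ ℤ_p⟦X,Y⟧` (easy half of Λ). [cite: SilvermanAEC2009, IV.6.3] -/
theorem isPadicInt_cob_of_isHom
    (hEnd : (G.map PadicInt.toZMod).subst (V.map PadicInt.toZMod).formalGroupLaw =
      MvPowerSeries.subst ![(G.map PadicInt.toZMod).subst (MvPowerSeries.X 0 : MvPowerSeries (Fin 2) (ZMod p)),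
        (G.map PadicInt.toZMod).subst (MvPowerSeries.X 1 : MvPowerSeries (Fin 2) (ZMod p))]
        (V.map PadicInt.toZMod).formalGroupLaw) :
    IsPadicInt (PowerSeries.subst (V.map PadicInt.Coe.ringHom).formalGroupLaw
          ((V.map PadicInt.Coe.ringHom).formalLog.subst (G.map PadicInt.Coe.ringHom)) -
        PowerSeries.subst (MvPowerSeries.X 0 : MvPowerSeries (Fin 2) ℚ_[p])
          ((V.map PadicInt.Coe.ringHom).formalLog.subst (G.map PadicInt.Coe.ringHom)) -
        PowerSeries.subst (MvPowerSeries.X 1 : MvPowerSeries (Fin 2) ℚ_[p])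
          ((V.map PadicInt.Coe.ringHom).formalLog.subst (G.map PadicInt.Coe.ringHom))) := by
  set ιQ := PadicInt.Coe.ringHom (p := p) with hιQ
  set W := V.map ιQ with hWdef
  set g := G.map ιQ with hgdef
  have hg0 : constantCoeff g = 0 := (constantCoeff_map_coe_and_toZMod G hG0).1
  set γZ : MvPowerSeries (Fin 2) ℤ_[p] := MvPowerSeries.subst ![G.subst V.formalGroupLaw, V.formalNeg.subst
    (MvPowerSeries.subst ![G.subst (MvPowerSeries.X 0 : MvPowerSeries (Fin 2) ℤ_[p]),
      G.subst (MvPowerSeries.X 1 : MvPowerSeries (Fin 2) ℤ_[p])] V.formalGroupLaw)] V.formalGroupLaw with hγZ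
  have hγmap : γZ.map ιQ = MvPowerSeries.subst ![g.subst W.formalGroupLaw, W.formalNeg.subst
      (MvPowerSeries.subst ![g.subst (MvPowerSeries.X 0 : MvPowerSeries (Fin 2) ℚ_[p]),
        g.subst (MvPowerSeries.X 1 : MvPowerSeries (Fin 2) ℚ_[p])] W.formalGroupLaw)] W.formalGroupLaw :=
    map_defect V ιQ G hG0
  have hγint : IsPadicInt (γZ.map ιQ) := isPadicInt_map γZ
  have hγ0 : MvPowerSeries.constantCoeff (γZ.map ιQ) = 0 := by rw [hγmap]; exact constantCoeff_defect W g hg0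
  -- `γ̄ = F̄(T, i(T)) = 0`
  have hred : γZ.map PadicInt.toZMod = 0 := by
    have hT : MvPowerSeries.constantCoeff ((G.map (PadicInt.toZMod (p := p))).subst (V.map PadicInt.toZMod).formalGroupLaw) = 0 :=
      (constantCoeff_subst_three (V.map PadicInt.toZMod) _ (constantCoeff_map_coe_and_toZMod G hG0).2).2.2
    rw [hγZ, map_defect V PadicInt.toZMod G hG0, ← hEnd]
    exact subst_pair_formalNeg_self (V.map PadicInt.toZMod) hT
  have hΛ : IsPadicInt (MvPowerSeries.C (p : ℚ_[p])⁻¹ * γZ.map ιQ) := isPadicInt_inv_mul_of_map_toZMod_eq_zero γZ hred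
  haveI : W.IsIntegral ℤ_[p] := V.isIntegral_map_coe
  have hp0 : (p : ℚ_[p]) ≠ 0 := by exact_mod_cast hp.out.ne_zero
  have e : γZ.map ιQ = (p : ℚ_[p]) • (MvPowerSeries.C (p : ℚ_[p])⁻¹ * γZ.map ιQ) := by
    rw [MvPowerSeries.smul_eq_C_mul, ← mul_assoc, ← map_mul, mul_inv_cancel₀ hp0, map_one, one_mul]
  have hG' : MvPowerSeries.constantCoeff (MvPowerSeries.C (p : ℚ_[p])⁻¹ * γZ.map ιQ) = 0 := by
    rw [map_mul, hγ0, mul_zero]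
  rw [← formalLog_subst_defect W g hg0, ← hγmap, e]
  exact isPadicInt_formalLog_subst_smul W hΛ hG'

/-! ## §3 The digit step -/

include hG0 in
/-- **DIGIT STEP.** For an endomorphism `G` mod `p` (`G ∈ Xℤ_p⟦X⟧`) there are a digit `a < p` and an endomorphism `G′`
mod `p` with **`log_W(G) − a·log_W − log_W(G′)(Xᵖ) ∈ ℤ_p⟦X⟧`**. Construction: `a = [X¹]Ḡ`, `G₁ = F(G, i([a]))` has
`log_W(G₁) = log_W(G) − a·log_W` (so the same coboundary, hence is an endomorphism mod `p` by STEP B) and `[X¹]Ḡ₁ = 0`,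
so `Ḡ₁ = ē(Xᵖ)` with `ē` an endomorphism of `F̄` (`exists_hom_expand_of_coeff_one_eq_zero`); `G′` = digit lift of
`ē`; then `G₁ ⊖ G′(Xᵖ) ≡ 0 (mod p)`, so `log_W(G₁) − log_W(G′(Xᵖ)) ∈ ℤ_p⟦X⟧` by Λ.
[cite: Katz1981CrystallineDieudonne, Thm. 5.3.3] [cite: SilvermanAEC2009, IV.4.3, IV.6.3, IV.7] -/
theorem digit_step (hp2 : p ≠ 2)
    (hEnd : (G.map PadicInt.toZMod).subst (V.map PadicInt.toZMod).formalGroupLaw =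
      MvPowerSeries.subst ![(G.map PadicInt.toZMod).subst (MvPowerSeries.X 0 : MvPowerSeries (Fin 2) (ZMod p)),
        (G.map PadicInt.toZMod).subst (MvPowerSeries.X 1 : MvPowerSeries (Fin 2) (ZMod p))]
        (V.map PadicInt.toZMod).formalGroupLaw) :
    ∃ (a : ℕ) (G' : ℤ_[p]⟦X⟧), a < p ∧ constantCoeff G' = 0 ∧
      (G'.map PadicInt.toZMod).subst (V.map PadicInt.toZMod).formalGroupLaw =
        MvPowerSeries.subst ![(G'.map PadicInt.toZMod).subst (MvPowerSeries.X 0 : MvPowerSeries (Fin 2) (ZMod p)),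
          (G'.map PadicInt.toZMod).subst (MvPowerSeries.X 1 : MvPowerSeries (Fin 2) (ZMod p))]
          (V.map PadicInt.toZMod).formalGroupLaw ∧
      IsPadicInt ((V.map PadicInt.Coe.ringHom).formalLog.subst (G.map PadicInt.Coe.ringHom) -
        (a : ℚ_[p]) • (V.map PadicInt.Coe.ringHom).formalLog -
        expand p hp.out.ne_zero ((V.map PadicInt.Coe.ringHom).formalLog.subst (G'.map PadicInt.Coe.ringHom))) := by
  set W := V.map (PadicInt.Coe.ringHom (p := p)) with hWdef
  set g := G.map (PadicInt.Coe.ringHom (p := p)) with hgdef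
  haveI : W.IsIntegral ℤ_[p] := V.isIntegral_map_coe
  have hp0 : p ≠ 0 := hp.out.ne_zero
  have hp0' : (p : ℚ_[p]) ≠ 0 := by exact_mod_cast hp0
  have hg0 : constantCoeff g = 0 := (constantCoeff_map_coe_and_toZMod G hG0).1
  have hgs : PowerSeries.HasSubst g := PowerSeries.HasSubst.of_constantCoeff_zero' hg0
  -- the digit
  set abar : ZMod p := coeff 1 (G.map (PadicInt.toZMod (p := p))) with habar
  set a : ℕ := abar.val with hadef
  -- `G₁ = F(G, i([a]))`
  have hN : constantCoeff (V.formalNeg.subst (V.formalMul a)) = 0 :=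
    constantCoeff_powerSeries_subst_eq_zero (V.constantCoeff_formalMul a) V.constantCoeff_formalNeg
  set G₁ : ℤ_[p]⟦X⟧ := MvPowerSeries.subst ![G, V.formalNeg.subst (V.formalMul a)] V.formalGroupLaw with hG₁def
  have hG₁0 : constantCoeff G₁ = 0 :=
    MvPowerSeries.constantCoeff_subst_eq_zero (WeierstrassCurve.hasSubst_pair hG0 hN)
      (fun i ↦ by fin_cases i; exacts [hG0, hN]) V.constantCoeff_formalGroupLaw
  set g₁ := G₁.map (PadicInt.Coe.ringHom (p := p)) with hg₁def
  have hg₁0 : constantCoeff g₁ = 0 := (constantCoeff_map_coe_and_toZMod G₁ hG₁0).1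
  have hMa : constantCoeff (W.formalMul a) = 0 := W.constantCoeff_formalMul a
  have hg₁ : g₁ = MvPowerSeries.subst ![g, W.formalNeg.subst (W.formalMul a)] W.formalGroupLaw := by
    rw [hg₁def, hG₁def, ← mvMap_eq_map, V.map_subst_pair_formalGroupLaw (PadicInt.Coe.ringHom (p := p)) hG0 hN,
      PowerSeries.map_subst (PowerSeries.HasSubst.of_constantCoeff_zero' (V.constantCoeff_formalMul a))]
    simp only [mvMap_eq_map, V.map_formalNeg (PadicInt.Coe.ringHom (p := p)), V.map_formalMul (PadicInt.Coe.ringHom (p := p)) a]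
    rfl
  -- `ℓ(G₁) = ℓ(G) − a·ℓ`
  have hℓg₁ : W.formalLog.subst g₁ = W.formalLog.subst g - (a : ℚ_[p]) • W.formalLog := by
    rw [hg₁, formalLog_subst_fsub W hg0 hMa, W.formalLog_subst_formalMul a, Nat.cast_smul_eq_nsmul]
  -- same coboundary ⟹ `Ḡ₁` is an endomorphism
  have hcob := isPadicInt_cob_of_isHom V G hG0 hEnd
  have hcob₁ : IsPadicInt (MvPowerSeries.C ((p : ℚ_[p]) ^ 0) *
      (PowerSeries.subst W.formalGroupLaw (W.formalLog.subst g₁) -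
        PowerSeries.subst (MvPowerSeries.X 0 : MvPowerSeries (Fin 2) ℚ_[p]) (W.formalLog.subst g₁) -
        PowerSeries.subst (MvPowerSeries.X 1 : MvPowerSeries (Fin 2) ℚ_[p]) (W.formalLog.subst g₁))) := by
    have e : PowerSeries.subst W.formalGroupLaw (W.formalLog.subst g₁) -
        PowerSeries.subst (MvPowerSeries.X 0 : MvPowerSeries (Fin 2) ℚ_[p]) (W.formalLog.subst g₁) -
        PowerSeries.subst (MvPowerSeries.X 1 : MvPowerSeries (Fin 2) ℚ_[p]) (W.formalLog.subst g₁) =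
        PowerSeries.subst W.formalGroupLaw (W.formalLog.subst g) -
        PowerSeries.subst (MvPowerSeries.X 0 : MvPowerSeries (Fin 2) ℚ_[p]) (W.formalLog.subst g) -
        PowerSeries.subst (MvPowerSeries.X 1 : MvPowerSeries (Fin 2) ℚ_[p]) (W.formalLog.subst g) := by
      rw [hℓg₁, PowerSeries.subst_sub W.hasSubst_formalGroupLaw, PowerSeries.subst_sub (PowerSeries.HasSubst.X _),
        PowerSeries.subst_sub (PowerSeries.HasSubst.X _), PowerSeries.subst_smul W.hasSubst_formalGroupLaw,
        PowerSeries.subst_smul (PowerSeries.HasSubst.X _), PowerSeries.subst_smul (PowerSeries.HasSubst.X _),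
        W.formalLog_subst_formalGroupLaw, smul_add]
      ring
    rw [pow_zero, map_one, one_mul, e]
    exact hcob
  have hEnd₁ := isHom_map_toZMod_of_cob V G₁ hG₁0 hp2 hcob₁
  -- `[X¹]Ḡ₁ = 0`
  have h1Q : coeff 1 g₁ = coeff 1 g - (a : ℚ_[p]) := by
    rw [← coeff_one_formalLog_subst W hg₁0, hℓg₁, map_sub, coeff_one_formalLog_subst W hg0, PowerSeries.coeff_smul,
      W.coeff_one_formalLog, smul_eq_mul, mul_one]
  have h1Z : coeff 1 G₁ = coeff 1 G - (a : ℤ_[p]) := by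
    apply Subtype.ext
    have := h1Q
    rw [hg₁def, hgdef, coeff_map, coeff_map] at this
    push_cast
    exact this
  have h1 : coeff 1 (G₁.map (PadicInt.toZMod (p := p))) = 0 := by
    rw [coeff_map, h1Z, map_sub, map_natCast, hadef, ZMod.natCast_zmod_val, habar, coeff_map, sub_self]
  -- `Ḡ₁ = ē(Xᵖ)`, lift `ē`
  obtain ⟨e, he0, he, heEnd⟩ := exists_hom_expand_of_coeff_one_eq_zero (V.map (PadicInt.toZMod (p := p)))
    (constantCoeff_map_coe_and_toZMod G₁ hG₁0).2 hEnd₁ h1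
  set G' : ℤ_[p]⟦X⟧ := PowerSeries.mk fun n ↦ ((coeff n e).val : ℤ_[p]) with hG'def
  have hG'bar : G'.map (PadicInt.toZMod (p := p)) = e := by
    ext n; rw [coeff_map, hG'def, coeff_mk, map_natCast, ZMod.natCast_zmod_val]
  have hG'0 : constantCoeff G' = 0 := by
    rw [← coeff_zero_eq_constantCoeff_apply, hG'def, coeff_mk, coeff_zero_eq_constantCoeff_apply, he0, ZMod.val_zero,
      Nat.cast_zero]
  refine ⟨a, G', ZMod.val_lt abar, hG'0, by rw [hG'bar]; exact heEnd, ?_⟩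
  -- `ζ = G₁ ⊖ G′(Xᵖ)` reduces to `0`
  set g' := G'.map (PadicInt.Coe.ringHom (p := p)) with hg'def
  have hg'0 : constantCoeff g' = 0 := (constantCoeff_map_coe_and_toZMod G' hG'0).1
  have hg's : PowerSeries.HasSubst g' := PowerSeries.HasSubst.of_constantCoeff_zero' hg'0
  have hEZ0 : constantCoeff (expand p hp0 G') = 0 := by rw [PowerSeries.constantCoeff_expand, hG'0]
  have hNZ : constantCoeff (V.formalNeg.subst (expand p hp0 G')) = 0 :=
    constantCoeff_powerSeries_subst_eq_zero hEZ0 V.constantCoeff_formalNeg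
  set ζZ : ℤ_[p]⟦X⟧ := MvPowerSeries.subst ![G₁, V.formalNeg.subst (expand p hp0 G')] V.formalGroupLaw with hζZ
  have hEQ0 : constantCoeff (expand p hp0 g') = 0 := by rw [PowerSeries.constantCoeff_expand, hg'0]
  have hζmap : ζZ.map (PadicInt.Coe.ringHom (p := p)) = MvPowerSeries.subst ![g₁, W.formalNeg.subst (expand p hp0 g')] W.formalGroupLaw := by
    rw [hζZ, ← mvMap_eq_map, V.map_subst_pair_formalGroupLaw (PadicInt.Coe.ringHom (p := p)) hG₁0 hNZ,
      PowerSeries.map_subst (PowerSeries.HasSubst.of_constantCoeff_zero' hEZ0)]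
    simp only [mvMap_eq_map, V.map_formalNeg (PadicInt.Coe.ringHom (p := p)), PowerSeries.map_expand]
    rfl
  have hζred : ζZ.map (PadicInt.toZMod (p := p)) = 0 := by
    have hEb0 : constantCoeff (expand p hp0 (G'.map (PadicInt.toZMod (p := p)))) = 0 := by
      rw [PowerSeries.constantCoeff_expand, (constantCoeff_map_coe_and_toZMod G' hG'0).2]
    rw [hζZ, ← mvMap_eq_map, V.map_subst_pair_formalGroupLaw (PadicInt.toZMod (p := p)) hG₁0 hNZ,
      PowerSeries.map_subst (PowerSeries.HasSubst.of_constantCoeff_zero' hEZ0)]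
    simp only [mvMap_eq_map, V.map_formalNeg (PadicInt.toZMod (p := p)), PowerSeries.map_expand, he, hG'bar]
    exact subst_pair_formalNeg_self (V.map (PadicInt.toZMod (p := p))) (by rw [← hG'bar]; exact hEb0)
  have hζint : IsPadicInt (ζZ.map (PadicInt.Coe.ringHom (p := p))) := isPadicInt_map ζZ
  have hζ0 : constantCoeff (ζZ.map (PadicInt.Coe.ringHom (p := p))) = 0 := by
    rw [hζmap]
    exact MvPowerSeries.constantCoeff_subst_eq_zero (WeierstrassCurve.hasSubst_pair hg₁0
      (constantCoeff_powerSeries_subst_eq_zero hEQ0 W.constantCoeff_formalNeg))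
      (fun i ↦ by fin_cases i; exacts [hg₁0, constantCoeff_powerSeries_subst_eq_zero hEQ0 W.constantCoeff_formalNeg])
      W.constantCoeff_formalGroupLaw
  have hΛ : IsPadicInt (MvPowerSeries.C (p : ℚ_[p])⁻¹ * ζZ.map (PadicInt.Coe.ringHom (p := p))) := isPadicInt_inv_mul_of_map_toZMod_eq_zero ζZ hζred
  have eζ : ζZ.map (PadicInt.Coe.ringHom (p := p)) = (p : ℚ_[p]) • (MvPowerSeries.C (p : ℚ_[p])⁻¹ * ζZ.map (PadicInt.Coe.ringHom (p := p))) := by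
    rw [MvPowerSeries.smul_eq_C_mul, ← mul_assoc, ← map_mul, mul_inv_cancel₀ hp0', map_one, one_mul]
  have hζ0' : MvPowerSeries.constantCoeff (MvPowerSeries.C (p : ℚ_[p])⁻¹ * ζZ.map (PadicInt.Coe.ringHom (p := p))) = 0 := by
    rw [map_mul]
    exact mul_eq_zero_of_right _ hζ0
  have hℓζ : IsPadicInt (W.formalLog.subst (ζZ.map (PadicInt.Coe.ringHom (p := p)))) := by
    rw [eζ]; exact isPadicInt_formalLog_subst_smul W hΛ hζ0'
  -- `ℓ(ζ) = ℓ(G₁) − ℓ(G′(Xᵖ)) = ℓ(G) − aℓ − ℓ(G′)(Xᵖ)`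
  have hexp : expand p hp0 (W.formalLog.subst g') = W.formalLog.subst (expand p hp0 g') := by
    rw [PowerSeries.expand_apply, PowerSeries.subst_comp_subst_apply hg's (PowerSeries.HasSubst.X_pow hp0),
      ← PowerSeries.expand_apply]
  rw [hexp, ← hℓg₁, ← formalLog_subst_fsub W hg₁0 hEQ0, ← hζmap]
  exact hℓζ

end Reduction

end Summit.BirchSwinnertonDyer.BirchSwinnertonDyer.Theorems.SecondKindLog
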